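import Summits.HodgeConjecture.HodgeConjecture.Theorems.F0P3cStCharTSFilteredNewtonHaar   -- ★ (C1b, LH5-p02) `map_restrict_eq_map_restrict_of_linearNewton`; brings ★ (C1a) `…FilteredNewton`
import Literature.Analysis.Calculus.UltrametricNewtonChart                                -- ★ p851977 (this seat, D1): `exists_depth_linearNewton_addSubgroup`, ball filtrations
import Mathlib.MeasureTheory.Integral.Lebesgue.Map
import HarnessLib

/-!
# F0 · P3c · ROAD «HC-D» (holder F0P2-p01) — FILE 2 of D1: «a strictly differentiable chart with invertible derivative INTEGRATES LIKE ITS LINEARISATION on every small box»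
# = ★ D1 `UltrametricNewtonChart` (strictness ⇒ filtered Newton `(N_L)`) ∘ ★ C1a∕C1b `FilteredNewton(Haar)` (Newton ⇒ coset images, injectivity, Haar transport)

Cell `pub/hodgecm-mathlib`, crux H413 = `stmt-HodgeConjecture-24833` (lane `--supports … --as helper`), route HCCMUnconditional; ROAD «HC-D» (LEAD T14-10, 2026-09-02T16:01Z):
the in-house pay-down of RUNG0 v2's named input `hDGliO` ((HC-D) `|D_G|^{−1∕2} ∈ L¹_loc`).  THEOREMS ONLY; ★-only imports.  This is the generic chart engine every local theorem of the
road (census `F0/P2/p01/g23/CENSUS-HCD.v1.F0P2p01g23.md` §1 (i)–(iii): submersion straightening of the Chevalley map, the descent slice at a non-regular semisimple point, the Slodowy slice at a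
minimal nilpotent) runs through: the slice maps are locally analytic with invertible derivative, hence strictly differentiable, hence — by this file — Haar-exact on small boxes.
HONEST LABEL: HC_CM is proved only modulo the 7 printed citations (2 remaining named inputs: hLiu418 = `stmt-HodgeConjecture-24832`, h413 = `stmt-HodgeConjecture-24833`) until rung 0
closes; count-neutral (closes no organ).

SETTING.  `𝕜` non-trivially normed field; `V` an ultrametric normed `𝕜`-space, proper (hence second countable), with its Borel σ-algebra and a measure `μ` finite on compacts and
left-invariant (additive Haar); `W` a normed `𝕜`-space (Borel); `φ : V → W` with `HasStrictFDerivAt φ (e : V →L[𝕜] W) x₀` for a continuous linear EQUIVALENCE `e : V ≃L[𝕜] W`; `Λ : ℕ → AddSubgroup V`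
the ball filtration `Λ j = closedBall 0 (r γʲ)` (`r > 0`, `0 < γ < 1`; exists by ★ `exists_addSubgroup_coe_eq_closedBall`).
* §1 **`exists_depth_chart`** — one depth `k₀` such that for every `k ≥ k₀`: (a) `φ` is injective on `x₀ + Λ k`; (b) for `j ≥ k`, `x ∈ Λ k`: `φ '' (x₀ + x + Λ j) = φ (x₀ + x) + e '' Λ j`
  (cosets onto cosets — in particular `φ '' (x₀ + Λ k) = φ x₀ + e '' Λ k` is OPEN); (c) HAAR TRANSPORT `(μ|_{Λ k}).map (v ↦ φ (x₀+v) − φ x₀) = (μ|_{Λ k}).map e`; (d) the INTEGRATION FORMULA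
  `∫⁻ v in Λ k, f (φ (x₀ + v)) ∂μ = ∫⁻ v in Λ k, f (φ x₀ + e v) ∂μ` for every measurable `f : W → ℝ≥0∞`.
* §2 projections `exists_depth_injOn`, `exists_depth_image_vadd_eq`, `exists_depth_lintegral_comp_eq` for by-name use.
No Jacobian determinant appears: on a small box an ultrametric strictly differentiable chart is MEASURE-ISOMORPHIC to its linearisation [Schikhof1984 §27; Serre1992LALG II.IV §9]; the
modulus `‖det e‖` enters only when the consumer evaluates `(μ|Λk).map e` (★ `Literature.MeasureTheory.Group.LocalFieldLinearJacobian`).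

## References
* [Schikhof1984] W. H. Schikhof, *Ultrametric Calculus* (1984), §27 Lemma 27.4–Thm. 27.5 (strict differentiability ⇒ balls onto balls, local invertibility).
* [Serre1992LALG] J.-P. Serre, *Lie Algebras and Lie Groups*, LNM 1500 (1992), Part II Ch. IV §9.
* [HarishChandra1970] Harish-Chandra (van Dijk), LNM 162 (1970), Part VII §1 Thm. 15 — the road's terminal statement (context only).
-/

set_option autoImplicit false
-- the mandated namespace has the single-problem summit's repeated segment (`HodgeConjecture.HodgeConjecture`)
set_option linter.dupNamespace false

noncomputable section

open MeasureTheory Filter Metric Set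
open scoped Topology Pointwise ENNReal
open Literature.Analysis.Calculus
open Summit.HodgeConjecture.HodgeConjecture.Cruxes.H413.F0P3cStCharTSFilteredNewton
open Summit.HodgeConjecture.HodgeConjecture.Cruxes.H413.F0P3cStCharTSFilteredNewtonHaar

namespace Summit.HodgeConjecture.HodgeConjecture.Cruxes.H413.F0P3cStCharTSStrictDerivNewton

variable {𝕜 : Type*} [NontriviallyNormedField 𝕜]
  {V : Type*} [NormedAddCommGroup V] [NormedSpace 𝕜 V] [IsUltrametricDist V] [ProperSpace V]
  [MeasurableSpace V] [BorelSpace V]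
  {W : Type*} [NormedAddCommGroup W] [NormedSpace 𝕜 W] [MeasurableSpace W] [BorelSpace W]
  (μ : Measure V) [IsFiniteMeasureOnCompacts μ] [μ.IsAddLeftInvariant]

/-! ## §0 Translation bookkeeping (no Newton hypothesis) -/

section Translate

variable {V' W' : Type*} [AddCommGroup V'] [AddCommGroup W']

/-- Injectivity of `v ↦ φ (x₀ + v) − φ x₀` on `S` is injectivity of `φ` on `x₀ +ᵥ S`. [folklore] -/
theorem injOn_vadd_of_injOn_sub (φ : V' → W') (x₀ : V') (S : Set V') (h : InjOn (fun v => φ (x₀ + v) - φ x₀) S) :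
    InjOn φ (x₀ +ᵥ S) := by
  rintro _ ⟨a, ha, rfl⟩ _ ⟨b, hb, rfl⟩ hab
  have : (fun v => φ (x₀ + v) - φ x₀) a = (fun v => φ (x₀ + v) - φ x₀) b := by
    simp only [vadd_eq_add] at hab; simp only [hab]
  simp [h ha hb this]

/-- Coset images of `v ↦ φ (x₀ + v) − φ x₀` translate to coset images of `φ`. [folklore] -/
theorem image_vadd_eq_of_image_sub (φ : V' → W') (x₀ x : V') (T : Set V') (L : V' → W')
    (h : (fun v => φ (x₀ + v) - φ x₀) '' (x +ᵥ T) = (fun v => φ (x₀ + v) - φ x₀) x +ᵥ L '' T) :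
    φ '' ((x₀ + x) +ᵥ T) = φ (x₀ + x) +ᵥ L '' T := by
  ext w
  constructor
  · rintro ⟨_, ⟨y, hy, rfl⟩, rfl⟩
    have hmem : (fun v => φ (x₀ + v) - φ x₀) (x + y) ∈ (fun v => φ (x₀ + v) - φ x₀) x +ᵥ L '' T := by
      rw [← h]; exact ⟨x + y, ⟨y, hy, rfl⟩, rfl⟩
    obtain ⟨_, ⟨z, hz, rfl⟩, hzeq⟩ := hmem
    refine ⟨L z, ⟨z, hz, rfl⟩, ?_⟩
    have hzeq' : φ (x₀ + x) - φ x₀ + L z = φ (x₀ + (x + y)) - φ x₀ := by simpa [vadd_eq_add] using hzeq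
    have hfin : φ (x₀ + (x + y)) = φ (x₀ + x) + L z := by
      have := congrArg (fun u => u + φ x₀) hzeq'
      simp only [sub_add_cancel] at this
      rw [← this]; abel
    simp only [vadd_eq_add]
    rw [add_assoc x₀ x y, hfin]
  · rintro ⟨_, ⟨z, hz, rfl⟩, rfl⟩
    have hmem : (fun v => φ (x₀ + v) - φ x₀) x + L z ∈ (fun v => φ (x₀ + v) - φ x₀) '' (x +ᵥ T) := by
      rw [h]; exact ⟨L z, ⟨z, hz, rfl⟩, rfl⟩
    obtain ⟨_, ⟨y, hy, rfl⟩, hyeq⟩ := hmem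
    refine ⟨x₀ + x + y, ⟨y, hy, by simp [vadd_eq_add, add_assoc]⟩, ?_⟩
    have hyeq' : φ (x₀ + (x + y)) - φ x₀ = φ (x₀ + x) - φ x₀ + L z := by simpa [vadd_eq_add] using hyeq
    have := congrArg (fun u => u + φ x₀) hyeq'
    simp only [sub_add_cancel] at this
    simp only [vadd_eq_add]
    rw [add_assoc, this]; abel

end Translate

/-! ## §1 The chart package at depth `k ≥ k₀` -/

omit [MeasurableSpace V] [BorelSpace V] [MeasurableSpace W] [BorelSpace W] in
/-- **Topological half (no measure): injectivity and coset images.**  There is `k₀` such that for all `k ≥ k₀`: `φ` is injective on `x₀ +ᵥ Λ k`, and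
`φ '' (x₀ + x +ᵥ Λ j) = φ (x₀ + x) +ᵥ e '' Λ j` for `j ≥ k`, `x ∈ Λ k` (compactness of the balls from `ProperSpace V`).  [cite: Schikhof1984, §27 Lemma 27.4–Thm. 27.5] [cite: Serre1992LALG, Part II Ch. IV §9] -/
theorem exists_depth_injOn_image {φ : V → W} {x₀ : V} (e : V ≃L[𝕜] W) (hφ : HasStrictFDerivAt φ (e : V →L[𝕜] W) x₀)
    {Λ : ℕ → AddSubgroup V} {r γ : ℝ} (hΛ : ∀ j, (Λ j : Set V) = closedBall (0 : V) (r * γ ^ j)) (hr : 0 < r) (hγ0 : 0 < γ) (hγ1 : γ < 1) :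
    ∃ k₀ : ℕ, ∀ k, k₀ ≤ k →
      InjOn φ (x₀ +ᵥ (Λ k : Set V)) ∧
      (∀ j, k ≤ j → ∀ x ∈ Λ k, φ '' ((x₀ + x) +ᵥ (Λ j : Set V)) = φ (x₀ + x) +ᵥ (e : V → W) '' (Λ j : Set V)) := by
  obtain ⟨k₀, hk₀⟩ := exists_depth_linearNewton_addSubgroup e hφ hΛ hr hγ0 hγ1
  have hanti : Antitone Λ := antitone_of_coe_eq_closedBall hΛ hr.le hγ0.le hγ1.le
  have hopen : ∀ j, IsOpen (Λ j : Set V) := isOpen_of_coe_eq_closedBall hΛ hr hγ0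
  have hbasis : ∀ U ∈ 𝓝 (0 : V), ∃ j, (Λ j : Set V) ⊆ U := exists_subset_of_mem_nhds_of_coe_eq_closedBall hΛ hr hγ1
  have hcomp : ∀ j, IsCompact (Λ j : Set V) := isCompact_of_coe_eq_closedBall hΛ
  refine ⟨k₀, fun k hk => ?_⟩
  have hN := hk₀ k hk
  have hcont : ContinuousOn (fun v => φ (x₀ + v) - φ x₀) (Λ k : Set V) :=
    continuousOn_of_linearNewton Λ _ e.toContinuousAddEquiv hanti hopen hbasis hN
  refine ⟨injOn_vadd_of_injOn_sub φ x₀ _ (injOn_of_linearNewton Λ _ e.toContinuousAddEquiv hanti hbasis hN), fun j hj x hx => ?_⟩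
  exact image_vadd_eq_of_image_sub φ x₀ x _ e
    (image_vadd_eq_of_linearNewton Λ _ e.toContinuousAddEquiv hanti hopen (hcomp k) hbasis hcont hN hj hx)

/-- **Strictly differentiable chart = its linearisation on small boxes.**  With `φ`, `e`, `x₀`, `Λ` as in the module docstring there is a depth `k₀` such that for every
`k ≥ k₀`: (a) `φ` is injective on `x₀ +ᵥ Λ k`; (b) `φ '' (x₀ + x +ᵥ Λ j) = φ (x₀ + x) +ᵥ e '' Λ j` for all `j ≥ k`, `x ∈ Λ k`; (c) `(μ|Λk).map (v ↦ φ (x₀+v) − φ x₀) = (μ|Λk).map e`;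
(d) `∫⁻ v in Λ k, f (φ (x₀ + v)) ∂μ = ∫⁻ v in Λ k, f (φ x₀ + e v) ∂μ` for every measurable `f`. [cite: Schikhof1984, §27 Lemma 27.4–Thm. 27.5] [cite: Serre1992LALG, Part II Ch. IV §9] -/
theorem exists_depth_chart {φ : V → W} {x₀ : V} (e : V ≃L[𝕜] W) (hφ : HasStrictFDerivAt φ (e : V →L[𝕜] W) x₀)
    {Λ : ℕ → AddSubgroup V} {r γ : ℝ} (hΛ : ∀ j, (Λ j : Set V) = closedBall (0 : V) (r * γ ^ j)) (hr : 0 < r) (hγ0 : 0 < γ) (hγ1 : γ < 1) :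
    ∃ k₀ : ℕ, ∀ k, k₀ ≤ k →
      InjOn φ (x₀ +ᵥ (Λ k : Set V)) ∧
      (∀ j, k ≤ j → ∀ x ∈ Λ k, φ '' ((x₀ + x) +ᵥ (Λ j : Set V)) = φ (x₀ + x) +ᵥ (e : V → W) '' (Λ j : Set V)) ∧
      (μ.restrict (Λ k : Set V)).map (fun v => φ (x₀ + v) - φ x₀) = (μ.restrict (Λ k : Set V)).map e ∧
      (∀ f : W → ℝ≥0∞, Measurable f → ∫⁻ v in (Λ k : Set V), f (φ (x₀ + v)) ∂μ = ∫⁻ v in (Λ k : Set V), f (φ x₀ + e v) ∂μ) := by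
  -- the Newton data from ★ D1
  obtain ⟨k₀, hk₀⟩ := exists_depth_linearNewton_addSubgroup e hφ hΛ hr hγ0 hγ1
  have hanti : Antitone Λ := antitone_of_coe_eq_closedBall hΛ hr.le hγ0.le hγ1.le
  have hopen : ∀ j, IsOpen (Λ j : Set V) := isOpen_of_coe_eq_closedBall hΛ hr hγ0
  have hbasis : ∀ U ∈ 𝓝 (0 : V), ∃ j, (Λ j : Set V) ⊆ U := exists_subset_of_mem_nhds_of_coe_eq_closedBall hΛ hr hγ1
  have hcomp : ∀ j, IsCompact (Λ j : Set V) := isCompact_of_coe_eq_closedBall hΛ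
  refine ⟨k₀, fun k hk => ?_⟩
  set φ₀ : V → W := fun v => φ (x₀ + v) - φ x₀ with hφ₀
  set L : V ≃ₜ+ W := e.toContinuousAddEquiv with hL
  have hN : ∀ j, k ≤ j → ∀ x ∈ Λ k, ∀ y ∈ Λ j, φ₀ (x + y) - φ₀ x - L y ∈ (L : V → W) '' (Λ (j + 1) : Set V) :=
    hk₀ k hk
  have hcont : ContinuousOn φ₀ (Λ k : Set V) := continuousOn_of_linearNewton Λ φ₀ L hanti hopen hbasis hN
  have h0 : L.symm (φ₀ 0) ∈ Λ k := by
    have : φ₀ 0 = 0 := by simp [hφ₀]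
    rw [this, map_zero]; exact (Λ k).zero_mem
  -- (a) injectivity, (b) coset images (★ C1a + §0)
  have hinj : InjOn φ (x₀ +ᵥ (Λ k : Set V)) :=
    injOn_vadd_of_injOn_sub φ x₀ _ (injOn_of_linearNewton Λ φ₀ L hanti hbasis hN)
  have himg : ∀ j, k ≤ j → ∀ x ∈ Λ k, φ '' ((x₀ + x) +ᵥ (Λ j : Set V)) = φ (x₀ + x) +ᵥ (e : V → W) '' (Λ j : Set V) :=
    fun j hj x hx => image_vadd_eq_of_image_sub φ x₀ x _ e
      (image_vadd_eq_of_linearNewton Λ φ₀ L hanti hopen (hcomp k) hbasis hcont hN hj hx)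
  -- (c) Haar transport (★ C1b)
  have hmap : (μ.restrict (Λ k : Set V)).map φ₀ = (μ.restrict (Λ k : Set V)).map e := by
    have h := map_restrict_eq_map_restrict_of_linearNewton Λ φ₀ L μ hanti hopen (hcomp k) hbasis hcont hN h0
    rw [h]
    rfl
  -- (d) the integration formula
  have hlin : ∀ f : W → ℝ≥0∞, Measurable f → ∫⁻ v in (Λ k : Set V), f (φ (x₀ + v)) ∂μ = ∫⁻ v in (Λ k : Set V), f (φ x₀ + e v) ∂μ := by
    intro f hf
    have hΛk : MeasurableSet (Λ k : Set V) := (hopen k).measurableSet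
    have hae : AEMeasurable φ₀ (μ.restrict (Λ k : Set V)) := hcont.aemeasurable hΛk
    have hg : Measurable fun w : W => f (φ x₀ + w) := hf.comp (measurable_const_add (φ x₀))
    have h1 : ∫⁻ v in (Λ k : Set V), f (φ (x₀ + v)) ∂μ = ∫⁻ w, f (φ x₀ + w) ∂((μ.restrict (Λ k : Set V)).map φ₀) := by
      rw [lintegral_map' hg.aemeasurable hae]
      refine lintegral_congr fun v => ?_
      simp [hφ₀]
    have h2 : ∫⁻ w, f (φ x₀ + w) ∂((μ.restrict (Λ k : Set V)).map e) = ∫⁻ v in (Λ k : Set V), f (φ x₀ + e v) ∂μ :=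
      lintegral_map hg e.continuous.measurable
    rw [h1, hmap, h2]
  exact ⟨hinj, himg, hmap, hlin⟩

/-! ## §2 Projections -/

omit [MeasurableSpace V] [BorelSpace V] [MeasurableSpace W] [BorelSpace W] in
/-- **Cosets onto cosets** (measure-free corollary): `φ '' (x₀ +ᵥ Λ k) = φ x₀ +ᵥ e '' Λ k` for every `k ≥ k₀` — the image of the box is an OPEN translate of a linear box.
[cite: Schikhof1984, §27 Lemma 27.4–Thm. 27.5] -/
theorem exists_depth_image_box_eq {φ : V → W} {x₀ : V} (e : V ≃L[𝕜] W) (hφ : HasStrictFDerivAt φ (e : V →L[𝕜] W) x₀)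
    {Λ : ℕ → AddSubgroup V} {r γ : ℝ} (hΛ : ∀ j, (Λ j : Set V) = closedBall (0 : V) (r * γ ^ j)) (hr : 0 < r) (hγ0 : 0 < γ) (hγ1 : γ < 1) :
    ∃ k₀ : ℕ, ∀ k, k₀ ≤ k → φ '' (x₀ +ᵥ (Λ k : Set V)) = φ x₀ +ᵥ (e : V → W) '' (Λ k : Set V) := by
  obtain ⟨k₀, h⟩ := exists_depth_injOn_image e hφ hΛ hr hγ0 hγ1
  refine ⟨k₀, fun k hk => ?_⟩
  simpa using (h k hk).2 k le_rfl 0 (Λ k).zero_mem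

/-- **Integration formula**: `∫⁻ v in Λ k, f (φ (x₀ + v)) ∂μ = ∫⁻ v in Λ k, f (φ x₀ + e v) ∂μ` for every measurable `f : W → ℝ≥0∞` and every `k ≥ k₀`, together with the Haar transport
identity `(μ|Λk).map (v ↦ φ (x₀+v) − φ x₀) = (μ|Λk).map e`. [cite: Schikhof1984, §27 Lemma 27.4–Thm. 27.5] [cite: Serre1992LALG, Part II Ch. IV §9] -/
theorem exists_depth_lintegral_comp_eq {φ : V → W} {x₀ : V} (e : V ≃L[𝕜] W) (hφ : HasStrictFDerivAt φ (e : V →L[𝕜] W) x₀)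
    {Λ : ℕ → AddSubgroup V} {r γ : ℝ} (hΛ : ∀ j, (Λ j : Set V) = closedBall (0 : V) (r * γ ^ j)) (hr : 0 < r) (hγ0 : 0 < γ) (hγ1 : γ < 1) :
    ∃ k₀ : ℕ, ∀ k, k₀ ≤ k →
      (μ.restrict (Λ k : Set V)).map (fun v => φ (x₀ + v) - φ x₀) = (μ.restrict (Λ k : Set V)).map e ∧
      ∀ f : W → ℝ≥0∞, Measurable f → ∫⁻ v in (Λ k : Set V), f (φ (x₀ + v)) ∂μ = ∫⁻ v in (Λ k : Set V), f (φ x₀ + e v) ∂μ := by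
  obtain ⟨k₀, h⟩ := exists_depth_chart μ e hφ hΛ hr hγ0 hγ1
  exact ⟨k₀, fun k hk => ⟨(h k hk).2.2.1, (h k hk).2.2.2⟩⟩

end Summit.HodgeConjecture.HodgeConjecture.Cruxes.H413.F0P3cStCharTSStrictDerivNewton

end
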